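import Summits.Ventures.PercRepro.C026CHubA

/-!
# C-026 when the neighbourhood of `c` is hub-like, II: the three cases of `Bot₃` (p5, gen 9)

With the `bot` structure of `C026CHubA.lean` (the cluster `M` of `c` is a star, the clusters `K`,
`L` of `a`, `b` arbitrary; the δ-states of the edges at `c`'s neighbourhood), `a ~ b` in the cut tree
`δ(ω)` of a `bot` configuration iff **Case 1** (a `c`-hub of `M` with edges to `a` and `b`) or
(**`a ~ c`** and **`c ~ b`**) — `IsBot.conn_cutSwap_iff'`, `bot3_iff'` — exactly as on a hub graph
(`C026HubB.lean`).  The two separation lemmas are closed-boundary arguments on the `a`-side sets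
`K ∪ {double hubs of M}` (`IsBot.not_conn_cutSwap_of_not_atoC`) and
`K ∪ {c} ∪ {c-hubs outside M} ∪ {double hubs of M}` (`IsBot.not_conn_cutSwap_of_not_ctoB`): every
δ-open edge leaving `K` enters `M` (`IsBot.conn_c_of_cutSwap_open`), and the edges at `c`'s
neighbourhood are read off `IsBot.cutSwap_link_ha'` / `IsBot.cutSwap_link_hb'` / `cutSwap_link_hc`.
-/

namespace PercRepro

namespace MultiGraph

variable {V E : Type*} {G : MultiGraph V E}

/-! ### The three cases of `Bot₃` when the neighbourhood of `c` is hub-like -/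

section Cases

variable {a b c : V} {ω : Config E}

/-- A boundary condition stated along links gives the closed-boundary condition of
`mem_of_conn_of_closed_boundary`. -/
theorem closed_boundary_of_link {ω' : Config E} {X : Set V}
    (h : ∀ e, ω' e = true → ∀ x y, G.Link e x y → x ∈ X → y ∈ X) :
    ∀ e, ω' e = true → (G.fst e ∈ X ↔ G.snd e ∈ X) :=
  fun e he => ⟨h e he _ _ (Or.inl ⟨rfl, rfl⟩), h e he _ _ (Or.inr ⟨rfl, rfl⟩)⟩

/-- **Without Case 1 and without `a ~ c`, `a ≁ b` in `δ(ω)`**: the set `K ∪ {double hubs of M}`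
(`K` the cluster of `a`; a double hub = a `c`-hub of `M` with an edge to `a`) has a closed
δ-boundary and misses `b`. -/
theorem IsBot.not_conn_cutSwap_of_not_atoC (hG : G.IsMarkHubGraph a b c c) (hs : G.IsSimple)
    (hab : a ≠ b) (hac : a ≠ c) (hbc : b ≠ c) (hbot : G.IsBot ω a b c)
    (h1 : ¬ G.Case1 ω a b c) (hA : ¬ G.AtoC ω a b c) :
    ¬ G.Conn (G.cutSwap a b c ω) a b := by
  intro hconn
  have hX := G.mem_of_conn_of_closed_boundary
    (X := {x | G.Conn ω a x ∨ (IsHubV a b c x ∧ G.OpenTo ω x c ∧ G.HasEdge x a)})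
    (closed_boundary_of_link fun e he x y hl hx => ?_) (Or.inl (Conn.refl G ω a)) hconn
  · rcases hX with h | ⟨h, -⟩
    · exact hbot.1 h
    · exact h.2.1 rfl
  simp only [Set.mem_setOf_eq] at hx ⊢
  rcases hx with hx | ⟨hxh, hxc, hxa⟩
  · -- `x ∈ K`
    by_cases hy : G.Conn ω a y
    · exact Or.inl hy
    have hcy := hbot.conn_c_of_cutSwap_open hl hx hy he
    rcases (hbot.conn_c_iff hG hs hac hbc y).1 hcy with rfl | ⟨hyh, hyc⟩
    · -- `y = c`: `x ∈ K` is adjacent to `c` — `a ~ c` in `δ(ω)`, excluded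
      exfalso
      by_cases hxa : x = a
      · rw [hxa] at hl
        exact hA (Or.inl ⟨e, hl⟩)
      have hxb : x ≠ b := by
        rintro rfl
        exact hbot.1 hx
      have hxc : x ≠ y := by
        rintro rfl
        exact hbot.2.1 hx
      have hxhub : G.IsHubLike a b y x := hG.isHubLike_of_link ⟨hxa, hxb, hxc⟩ hl
      exact hA (Or.inr ⟨x, ⟨hxa, hxb, hxc⟩, (hbot.conn_mark_hubLike_iff hxhub ⟨hxa, hxb, hxc⟩
        (Or.inl rfl)).1 hx, ⟨e, hl⟩⟩)
    · -- `y` is a `c`-hub of `M`; its neighbour `x ∈ K` is a mark, so `x = a` and `y` is a double hub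
      have hyhub : G.IsHubLike a b c y := by
        obtain ⟨g, -, hg⟩ := hyc
        exact hG.isHubLike_of_link hyh hg
      rcases hyhub.mark_of_link hl.symm with rfl | rfl | rfl
      · exact Or.inr ⟨hyh, hyc, ⟨e, hl.symm⟩⟩
      · exact absurd hx hbot.1
      · exact absurd hx hbot.2.1
  · -- `x` is a double hub of `M`: its neighbour `y` is a mark
    have hxhub : G.IsHubLike a b c x := by
      obtain ⟨g, -, hg⟩ := hxc
      exact hG.isHubLike_of_link hxh hg
    rcases hxhub.mark_of_link hl with rfl | rfl | rfl
    · exact Or.inl (Conn.refl G ω y)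
    · exact absurd ⟨x, hxh, hxc, hxa, ⟨e, hl⟩⟩ h1
    · exact absurd hxc ((cutSwap_link_hc hs hl).1 he)

/-- **Without Case 1 and without `c ~ b`, `a ≁ b` in `δ(ω)`**: the set
`K ∪ {c} ∪ {c-hubs outside M} ∪ {double hubs of M}` has a closed δ-boundary and misses `b`. -/
theorem IsBot.not_conn_cutSwap_of_not_ctoB (hG : G.IsMarkHubGraph a b c c) (hs : G.IsSimple)
    (hab : a ≠ b) (hac : a ≠ c) (hbc : b ≠ c) (hbot : G.IsBot ω a b c)
    (h1 : ¬ G.Case1 ω a b c) (hB : ¬ G.CtoB ω a b c) :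
    ¬ G.Conn (G.cutSwap a b c ω) a b := by
  intro hconn
  have hX := G.mem_of_conn_of_closed_boundary
    (X := {x | G.Conn ω a x ∨ x = c ∨ (IsHubV a b c x ∧ G.HasEdge x c ∧ ¬ G.OpenTo ω x c) ∨
      (IsHubV a b c x ∧ G.OpenTo ω x c ∧ G.HasEdge x a)})
    (closed_boundary_of_link fun e he x y hl hx => ?_) (Or.inl (Conn.refl G ω a)) hconn
  · rcases hX with h | h | ⟨h, -⟩ | ⟨h, -⟩
    · exact hbot.1 h
    · exact hbc h
    · exact h.2.1 rfl
    · exact h.2.1 rfl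
  simp only [Set.mem_setOf_eq] at hx ⊢
  rcases hx with hx | rfl | ⟨hxh, hxc, hxo⟩ | ⟨hxh, hxc, hxa⟩
  · -- `x ∈ K`: a δ-open edge out of `K` enters `M`
    by_cases hy : G.Conn ω a y
    · exact Or.inl hy
    have hcy := hbot.conn_c_of_cutSwap_open hl hx hy he
    rcases (hbot.conn_c_iff hG hs hac hbc y).1 hcy with rfl | ⟨hyh, hyc⟩
    · exact Or.inr (Or.inl rfl)
    · have hyhub : G.IsHubLike a b c y := by
        obtain ⟨g, -, hg⟩ := hyc
        exact hG.isHubLike_of_link hyh hg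
      rcases hyhub.mark_of_link hl.symm with rfl | rfl | rfl
      · exact Or.inr (Or.inr (Or.inr ⟨hyh, hyc, ⟨e, hl.symm⟩⟩))
      · exact absurd hx hbot.1
      · exact absurd hx hbot.2.1
  · -- `x = c`: the neighbours of `c` are `a`, `b` (excluded) and the `c`-hubs
    have hyx : y ≠ x := by
      rintro rfl
      exact hs.1 e (by rcases hl with ⟨h1, h2⟩ | ⟨h1, h2⟩ <;> rw [h1, h2])
    by_cases hya : y = a
    · exact Or.inl (by rw [hya]; exact Conn.refl G ω a)
    by_cases hyb : y = b
    · exfalso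
      rw [hyb] at hl
      exact hB (Or.inl ⟨e, hl.symm⟩)
    by_cases hyc : G.OpenTo ω y x
    · exact absurd hyc ((cutSwap_link_hc hs hl.symm).1 he)
    · exact Or.inr (Or.inr (Or.inl ⟨⟨hya, hyb, hyx⟩, ⟨e, hl.symm⟩, hyc⟩))
  · -- `x` is a `c`-hub outside `M`: its `b`-edge is δ-open only when `x` is isolated (Case 2)
    have hxhub : G.IsHubLike a b c x := by
      obtain ⟨g, hg⟩ := hxc
      exact hG.isHubLike_of_link hxh hg
    rcases hxhub.mark_of_link hl with rfl | rfl | rfl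
    · exact Or.inl (Conn.refl G ω y)
    · exfalso
      rcases (hbot.cutSwap_link_hb' hG hs hab hac hbc hxh hxhub hl).1 he with h | hno
      · exact hxo h
      · exact hB (Or.inr ⟨x, hxh, hno, hxc, ⟨e, hl⟩⟩)
    · exact Or.inr (Or.inl rfl)
  · -- `x` is a double hub of `M`: its neighbour `y` is a mark
    have hxhub : G.IsHubLike a b c x := by
      obtain ⟨g, -, hg⟩ := hxc
      exact hG.isHubLike_of_link hxh hg
    rcases hxhub.mark_of_link hl with rfl | rfl | rfl
    · exact Or.inl (Conn.refl G ω y)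
    · exact absurd ⟨x, hxh, hxc, hxa, ⟨e, hl⟩⟩ h1
    · exact absurd hxc ((cutSwap_link_hc hs hl).1 he)

/-- **`a ~ b` in `δ(ω)` when the neighbourhood of `c` is hub-like, `ω ∈ bot`**: Case 1, or `a ~ c`
and `c ~ b` — exactly as on a hub graph (`IsBot.conn_cutSwap_iff`), with `K`, `L` arbitrary. -/
theorem IsBot.conn_cutSwap_iff' (hG : G.IsMarkHubGraph a b c c) (hs : G.IsSimple) (hab : a ≠ b)
    (hac : a ≠ c) (hbc : b ≠ c) (hbot : G.IsBot ω a b c) :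
    G.Conn (G.cutSwap a b c ω) a b ↔ G.Case1 ω a b c ∨ (G.AtoC ω a b c ∧ G.CtoB ω a b c) := by
  constructor
  · intro hconn
    by_cases h1 : G.Case1 ω a b c
    · exact Or.inl h1
    by_cases hA : G.AtoC ω a b c
    · by_cases hB : G.CtoB ω a b c
      · exact Or.inr ⟨hA, hB⟩
      · exact absurd hconn (hbot.not_conn_cutSwap_of_not_ctoB hG hs hab hac hbc h1 hB)
    · exact absurd hconn (hbot.not_conn_cutSwap_of_not_atoC hG hs hab hac hbc h1 hA)
  · rintro (⟨h, hh, hc, ⟨ea, hla⟩, ⟨eb, hlb⟩⟩ | ⟨hA, hB⟩)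
    · have hhub : G.IsHubLike a b c h := by
        obtain ⟨g, -, hg⟩ := hc
        exact hG.isHubLike_of_link hh hg
      have h1 : G.cutSwap a b c ω ea = true :=
        (hbot.cutSwap_link_ha' hG hs hac hbc hh hla).2 (Or.inr hc)
      have h2 : G.cutSwap a b c ω eb = true :=
        (hbot.cutSwap_link_hb' hG hs hab hac hbc hh hhub hlb).2 (Or.inl hc)
      exact (hla.conn h1).symm.trans (hlb.conn h2)
    · have hAC : G.Conn (G.cutSwap a b c ω) a c := by
        rcases hA with ⟨e, hl⟩ | ⟨h, hh, ha, ⟨ec, hlc⟩⟩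
        · exact hl.conn (hbot.cutSwap_link_ac hac hl)
        · obtain ⟨ea, hea, hla⟩ := ha
          have h1 : G.cutSwap a b c ω ea = true :=
            (hbot.cutSwap_link_ha' hG hs hac hbc hh hla).2 (Or.inl ⟨ea, hea, hla⟩)
          have h2 : G.cutSwap a b c ω ec = true :=
            (cutSwap_link_hc hs hlc).2 fun hc =>
              hbot.openTo_unique (Or.inl rfl) (Or.inr (Or.inr rfl)) hac ⟨ea, hea, hla⟩ hc
          exact (hla.conn h1).symm.trans (hlc.conn h2)
      have hCB : G.Conn (G.cutSwap a b c ω) c b := by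
        rcases hB with ⟨e, hl⟩ | ⟨h, hh, hno, ⟨ec, hlc⟩, ⟨eb, hlb⟩⟩
        · exact (hl.conn (hbot.cutSwap_link_bc hbc hl)).symm
        · have hhub : G.IsHubLike a b c h := hG.isHubLike_of_link hh hlc
          have h1 : G.cutSwap a b c ω ec = true := (cutSwap_link_hc hs hlc).2 hno.2.2
          have h2 : G.cutSwap a b c ω eb = true :=
            (hbot.cutSwap_link_hb' hG hs hab hac hbc hh hhub hlb).2 (Or.inr hno)
          exact (hlc.conn h1).symm.trans (hlb.conn h2)
      exact hAC.trans hCB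

/-- **`Bot₃` when the neighbourhood of `c` is hub-like**: `bot` and (Case 1 or `a ~ c ~ b`). -/
theorem bot3_iff' (hG : G.IsMarkHubGraph a b c c) (hs : G.IsSimple) (hab : a ≠ b) (hac : a ≠ c)
    (hbc : b ≠ c) : G.Bot3 ω a b c ↔
      G.IsBot ω a b c ∧ (G.Case1 ω a b c ∨ (G.AtoC ω a b c ∧ G.CtoB ω a b c)) := by
  constructor
  · rintro ⟨hbot, hconn⟩
    exact ⟨hbot, (hbot.conn_cutSwap_iff' hG hs hab hac hbc).1 hconn⟩
  · rintro ⟨hbot, h⟩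
    exact ⟨hbot, (hbot.conn_cutSwap_iff' hG hs hab hac hbc).2 h⟩

end Cases

end MultiGraph

end PercRepro
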